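import Summits.QuantumFields.BalabanUV.T4Continuum.Support.ShellMeasureLandauWilsonSquares
import Mathlib.Analysis.Complex.Schwarz

/-!
# `T4Continuum.ShellMeasureWilsonSquareSchwarz` — owner audit (γ6) «COUPLING»: the Wilson SQUARE slot of END-II is
# SECOND ORDER in the small-field window — the two-radii (Schwarz) junction for S72 ∕ S74
(cell `pub-balaban`, sub-cell `t4`, spine estimate NE7c (node U5b); owner lineage `b2b-balaban-t4-ne7c-p1` gen 32,
owner table `t4/b2b-balaban-t4-ne7c-p1/LEAVES-NE7c-P1.md` row **S85**; ADDITIVE — imports S74 f1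
`ShellMeasureLandauWilsonSquares` (hence S72 `ShellMeasureWilsonSquare`, S16 `ShellMeasureRayWiring`) and Mathlib's Schwarz
lemma ONLY; [folklore]; 0 `def`, 0 `def … : Prop`, 0 sorry, 0 citation tags)

HONEST FRAMING.  Finite four-torus programme, rung (B)+1 only — NOT infinite volume, NOT a mass gap, NOT the Clay
problem, NOT summit progress; (B), `BetaPertHyp`, (B^μ) not consumed.  NE7c (`T4IndicatorShell.ShellWeightBound`) is NOT
PRINTED in [Balaban 1983–89] and NOT PROVED; «NE7c ⇐ the named binders» (trigger c3).  Nothing printed is asserted here;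
no estimate of Bałaban's is discharged; this file is complex-analytic PLUMBING (the Schwarz lemma for Banach-valued curves)
plus the real arithmetic that makes the audit kernel-precise.  Equation numbers below LOCATE displayed shapes only.

THE AUDIT THIS FILE SERVES (owner NOTE N-ne7cp1-g32-1, an audit of OUR wiring — like γ1 ∕ F-g30-1 ∕ F-g31-1, not of
print).  S74 `ShellMeasureLandauWilsonSquares.hE_landau_wilsonSquares` (and its abstract cores S74 §3
`hE_of_wilsonPlaquettes`, S72 §4 `hE_of_wilsonSquares`) display the Wilson ray constant `B_W = 3H̄∕(Rad − 1)`,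
`Rad = r_Φ∕S`, with `H̄ ≥ Σ_p |β|·(d_p + H_p)·H_p` and `H_p` a sup over the WHOLE analyticity disc `|w| < Rad` of the
plaquette curve (`H_p = κ_c p·z̄ + expTail₂(m_w κ_w p z̄)`, `z̄` built from B11's LEVEL-FREE constants).  That is FIRST ORDER
in the window radius `S` (ONE Cauchy factor `1∕(Rad − 1)`): with `#P ≤ c_geo∕η_j⁴` and `H_p = η_j²h`,
`B_W ≥ 3c_geo·|β_j|·h²·S_j∕r_Φ ∝ β_j·ε_j = p₀(g_j)∕g_j` (B14 (2.4) `ε_j = g_jA₀(log g_j^{−2})^{p₀}`, `β_j = g_j^{−2}`,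
`S_j ∼ c₀Mε_j`) — the displayed slot constant grows like `g^{−1}` as the coupling shrinks (§1 `oneRadius_BW_unbounded`).
The natural size is SECOND ORDER: by the SCHWARZ LEMMA (§2, Mathlib `Complex.dist_le_div_mul_dist_of_mapsTo_ball` for
Banach-valued maps) a curve with oscillation `≤ O_p` on `|w| < Rad` has oscillation `≤ O_p·R₁∕Rad` and sup
`≤ d_p + O_p·R₁∕Rad` on the INNER disc `|w| < R₁`, and S72 fired AT RADIUS `R₁` (§3 `hE_of_wilsonSquares_innerRadius`;
`R₁ = 2`: `hE_of_wilsonSquares_schwarz`, §4 `hE_of_wilsonPlaquettes_schwarz`) gives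
`B_W⁽²⁾ = 3·Σ_p |β|·(d_p + 2O_p∕Rad)·(2O_p∕Rad)`, i.e. `∝ β_j·ε_j² = p₀(g_j)²` per block — the coupling CANCELS (§1
`twoRadii_budget_le`, `twoRadii_coupling`), exactly as the Wilson action's variation over a small-field window in print
(`∝ g^{−2}·ε² = p₀²`).  The two-radii constant is NEVER larger than the one-radius one (`twoRadii_le_oneRadius`:
`12x∕Rad² ≤ 3x∕(Rad−1)` ⟺ `(Rad−2)² ≥ 0`).
CLASSIFICATION (honest).  NOT a K-uniformity failure: at the LIVE levels `K − N₁ ≤ j ≤ K` (the infrared end of the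
trajectory) `g_j`, `ε_j`, `p₀(g_j)`, `R_j` are K-UNIFORM — unlike `η_j = L^{−j}` (F-g31-1) and the lattice volume
(F-g30-1); END-I's `D_j ≤ D̄` is inhabited either way.  It is a CONSTANT audit: `D̄ ∝ g_IR^{−1}·polylog` as displayed vs
`∝ polylog` after the re-cut.  The non-Wilson slot `B_E` (first-order terms, S71 f2 ∕ S78) and the classifier's (SM)
(already `(Rad − 1)^{−2}`) are right at one radius and are NOT touched.

WHAT IS PROVED ([folklore]).  §1 the arithmetic in S74's literal shapes; §2 the Schwarz transfer (`norm_sub_le_div_mul_norm`,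
`inner_osc_le`, `inner_sup_le`); §3 the junction at an inner radius (S72 BY NAME) + the `R₁ = 2` form + non-vacuity;
§4 the letter-curve form (S74 §3's hypotheses VERBATIM on the big disc, budget second order).  The chart-ray ∕ pinned
re-instantiation of S74 §4 ∕ f2 (one more located number `2S ≤ r_Φ`, implied by T-NE7c-11's `7S < r_Φ`) is row S85 f2.
LOCATED INPUTS (displayed, NOT discharged): as S74 — the curves, their Stokes-currency bounds, unitarity on the real
segment, `d_p`; NOTHING in the countdown moves; NE7c NOT PROVED; spine PROVED 0∕9.  HONEST DEPENDENCY (cell): continuum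
YM on T⁴ ⇐ BetaPertH ∧ nine spine estimates (0/9 proved); BetaPertH ⇐ (D1) ∧ (D4) ∧ CAP+tail; G-an2-4 gates asym, D1
and NE2/3/4.
-/

noncomputable section

open Set Metric Complex
open scoped Matrix

namespace Summit.QuantumFields.BalabanUV.T4Continuum.ShellMeasureWilsonSquareSchwarz

open Literature.MathematicalPhysics.QuantumFieldTheory.Balaban1983to89
open T4ShellMeasurePlaquette (plaquetteFn differentiableOn_plaquetteFn expTail₂)
open Summit.QuantumFields.BalabanUV.T4Continuum.ShellMeasureWilsonSquare (hE_of_wilsonSquares)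
open Summit.QuantumFields.BalabanUV.T4Continuum.ShellMeasureLandauWilsonSquares
  (norm_plaquetteFn_osc_le one_add_plaquetteFn one_add_curve_mul_conjTranspose norm_curve_le)

/-! ## §1 The arithmetic of the audit, in S74's literal shapes -/

section Arithmetic

/-- **S74's ONE-RADIUS CONSTANT FOR A BLOCK OF ALIKE FLAT PLAQUETTES.**  With `c_geo∕η⁴` plaquettes, `d = 0` and
`H_p = η²·h` (the Stokes currency, F-g31-1), S74's `3·(Σ_p |β|(d_p + H_p)H_p)∕(Rad − 1)` is `3·c_geo·|β|·h²∕(Rad − 1)`: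
η-FREE, but with ONE factor `1∕(Rad − 1)` only. [folklore] -/
theorem oneRadius_BW_eq {cgeo β h Rad η : ℝ} (hη : η ≠ 0) :
    3 * (cgeo / η ^ 4 * (|β| * (0 + η ^ 2 * h) * (η ^ 2 * h))) / (Rad - 1) =
      3 * cgeo * |β| * h ^ 2 / (Rad - 1) := by
  have hη4 : η ^ 4 ≠ 0 := pow_ne_zero 4 hη
  field_simp
  ring

/-- … and since `Rad − 1 ≤ Rad = r_Φ∕S`, it is AT LEAST `3·c_geo·|β|·h²·(S∕r_Φ)` — FIRST ORDER in the window radius `S`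
(`0 < S < r_Φ`, `0 ≤ c_geo`). [folklore] -/
theorem oneRadius_BW_ge {cgeo β h rΦ S : ℝ} (hc : 0 ≤ cgeo) (hS : 0 < S) (hSr : S < rΦ) :
    3 * cgeo * |β| * h ^ 2 * (S / rΦ) ≤ 3 * cgeo * |β| * h ^ 2 / (rΦ / S - 1) := by
  have hRad1 : 0 < rΦ / S - 1 := by rw [sub_pos, lt_div_iff₀ hS]; linarith
  have hK : 0 ≤ 3 * cgeo * |β| * h ^ 2 := by positivity
  have h1 : S / rΦ = 1 / (rΦ / S) := by rw [one_div_div]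
  rw [h1, div_eq_mul_one_div (3 * cgeo * |β| * h ^ 2) (rΦ / S - 1)]
  exact mul_le_mul_of_nonneg_left (one_div_le_one_div_of_le hRad1 (by linarith)) hK

/-- **IN THE PRINTED CURRENCIES THE ONE-RADIUS CONSTANT IS `∝ 1∕g`.**  With `β = g^{−2}`, window `S = c₀·ε` and
B14 (2.4)'s `ε = g·p` (`p = A₀(log g^{−2})^{p₀}`), the lower bound `3c_geo|β|h²·(S∕r_Φ)` equals
`3c_geo·h²·c₀·p∕(g·r_Φ)` (`0 < g`). [folklore] -/
theorem oneRadius_BW_coupling {cgeo h c₀ p g rΦ : ℝ} (hg : 0 < g) (hr : rΦ ≠ 0) :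
    3 * cgeo * |(g ^ 2)⁻¹| * h ^ 2 * (c₀ * (g * p) / rΦ) = 3 * cgeo * h ^ 2 * c₀ * p / (g * rΦ) := by
  rw [abs_of_pos (by positivity)]
  field_simp

/-- … hence UNBOUNDED as `g → 0⁺`: for every bound `B` there is `g₀ > 0` below which `3c_geo·h²·c₀·p∕(g·r_Φ)`
exceeds `B` (all constants positive). [folklore] -/
theorem oneRadius_BW_unbounded {cgeo h c₀ p rΦ : ℝ} (hc : 0 < cgeo) (hh : 0 < h) (hc₀ : 0 < c₀) (hp : 0 < p)
    (hr : 0 < rΦ) (B : ℝ) :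
    ∃ g₀ : ℝ, 0 < g₀ ∧ ∀ g : ℝ, 0 < g → g < g₀ → B < 3 * cgeo * h ^ 2 * c₀ * p / (g * rΦ) := by
  set C : ℝ := 3 * cgeo * h ^ 2 * c₀ * p / rΦ with hC
  have hCpos : 0 < C := by rw [hC]; positivity
  have hB1 : 0 < |B| + 1 := by positivity
  refine ⟨C / (|B| + 1), by positivity, fun g hg hlt => ?_⟩
  have hCg : 3 * cgeo * h ^ 2 * c₀ * p / (g * rΦ) = C / g := by
    rw [hC]; field_simp
  rw [hCg, lt_div_iff₀ hg]
  have h1 : (|B| + 1) * g < C := by have h := (lt_div_iff₀ hB1).1 hlt; linarith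
  have hB : B ≤ |B| := le_abs_self B
  nlinarith

/-- **THE TWO-RADII COST PER PLAQUETTE IS SECOND ORDER IN THE WINDOW.**  With the frozen prefactor `d ≤ c_d·ε·η²`
(B14 (2.17) TYPE at the chart centre), the Stokes oscillation `O ≤ η²·o`, and `1∕Rad ≤ c₀·ε∕r_Φ` (`Rad = r_Φ∕S`,
`S ≤ c₀ε`): `|β|·(d + 2O∕Rad)·(2O∕Rad) ≤ |β|·ε²·η⁴·(c_d + 2·o·(c₀∕r_Φ))·(2·o·(c₀∕r_Φ))`. [folklore] -/
theorem twoRadii_cost_le {β d O Rad η ε cd o c₀ rΦ : ℝ} (hRad : 0 < Rad) (ho : 0 ≤ o)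
    (hd0 : 0 ≤ d) (hd : d ≤ cd * ε * η ^ 2) (hO0 : 0 ≤ O) (hO : O ≤ η ^ 2 * o) (hinv : 1 / Rad ≤ c₀ * ε / rΦ) :
    |β| * (d + 2 * O / Rad) * (2 * O / Rad) ≤
      |β| * (ε ^ 2 * η ^ 4 * ((cd + 2 * o * (c₀ / rΦ)) * (2 * o * (c₀ / rΦ)))) := by
  have hR0 : 0 ≤ 1 / Rad := by positivity
  have hcr : 0 ≤ c₀ * ε / rΦ := hR0.trans hinv
  have h2 : 2 * O / Rad ≤ 2 * (η ^ 2 * o) * (c₀ * ε / rΦ) := by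
    rw [div_eq_mul_one_div]
    exact mul_le_mul (by linarith) hinv hR0 (by positivity)
  have h2' : 0 ≤ 2 * O / Rad := by positivity
  have h3 : d + 2 * O / Rad ≤ cd * ε * η ^ 2 + 2 * (η ^ 2 * o) * (c₀ * ε / rΦ) := add_le_add hd h2
  have h4 : (d + 2 * O / Rad) * (2 * O / Rad) ≤
      (cd * ε * η ^ 2 + 2 * (η ^ 2 * o) * (c₀ * ε / rΦ)) * (2 * (η ^ 2 * o) * (c₀ * ε / rΦ)) :=
    mul_le_mul h3 h2 h2' (by linarith [add_nonneg hd0 h2'])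
  have e : (cd * ε * η ^ 2 + 2 * (η ^ 2 * o) * (c₀ * ε / rΦ)) * (2 * (η ^ 2 * o) * (c₀ * ε / rΦ)) =
      ε ^ 2 * η ^ 4 * ((cd + 2 * o * (c₀ / rΦ)) * (2 * o * (c₀ / rΦ))) := by ring
  rw [mul_assoc, ← e]
  exact mul_le_mul_of_nonneg_left h4 (abs_nonneg β)

/-- **THE TWO-RADII BUDGET OF THE BLOCK IS η-FREE AND SECOND ORDER IN `ε`**: over at most `c_geo∕η⁴` plaquettes with the
per-plaquette data of `twoRadii_cost_le`, `Σ_p |β|(d_p + 2O_p∕Rad)(2O_p∕Rad) ≤ c_geo·|β|·ε²·(c_d + 2oc₀∕r_Φ)(2oc₀∕r_Φ)`.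
[folklore] -/
theorem twoRadii_budget_le {ι : Type*} (P : Finset ι) {d O : ι → ℝ} {β Rad η ε cd o c₀ rΦ cgeo : ℝ} (hη : 0 < η)
    (hRad : 0 < Rad) (ho : 0 ≤ o) (hcd : 0 ≤ cd) (hc₀r : 0 ≤ c₀ / rΦ)
    (hcard : (P.card : ℝ) ≤ cgeo / η ^ 4)
    (hd0 : ∀ p ∈ P, 0 ≤ d p) (hd : ∀ p ∈ P, d p ≤ cd * ε * η ^ 2) (hO0 : ∀ p ∈ P, 0 ≤ O p)
    (hO : ∀ p ∈ P, O p ≤ η ^ 2 * o) (hinv : 1 / Rad ≤ c₀ * ε / rΦ) :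
    ∑ p ∈ P, |β| * (d p + 2 * O p / Rad) * (2 * O p / Rad) ≤
      cgeo * |β| * ε ^ 2 * ((cd + 2 * o * (c₀ / rΦ)) * (2 * o * (c₀ / rΦ))) := by
  have hη4 : 0 < η ^ 4 := by positivity
  have hK : 0 ≤ (cd + 2 * o * (c₀ / rΦ)) * (2 * o * (c₀ / rΦ)) := by positivity
  calc ∑ p ∈ P, |β| * (d p + 2 * O p / Rad) * (2 * O p / Rad)
      ≤ ∑ _p ∈ P, |β| * (ε ^ 2 * η ^ 4 * ((cd + 2 * o * (c₀ / rΦ)) * (2 * o * (c₀ / rΦ)))) :=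
        Finset.sum_le_sum fun p hp => twoRadii_cost_le hRad ho (hd0 p hp) (hd p hp) (hO0 p hp) (hO p hp) hinv
    _ = P.card * (η ^ 4 * (|β| * ε ^ 2 * ((cd + 2 * o * (c₀ / rΦ)) * (2 * o * (c₀ / rΦ))))) := by
        rw [Finset.sum_const, nsmul_eq_mul]; ring
    _ ≤ cgeo / η ^ 4 * (η ^ 4 * (|β| * ε ^ 2 * ((cd + 2 * o * (c₀ / rΦ)) * (2 * o * (c₀ / rΦ))))) :=
        mul_le_mul_of_nonneg_right hcard (by positivity)
    _ = cgeo * |β| * ε ^ 2 * ((cd + 2 * o * (c₀ / rΦ)) * (2 * o * (c₀ / rΦ))) := by field_simp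

/-- **THE COUPLING CANCELS IN THE TWO-RADII BUDGET**: with `β = g^{−2}` and `ε = g·p`, `|β|·ε²·K = p²·K` (`g ≠ 0`).
[folklore] -/
theorem twoRadii_coupling {g p K : ℝ} (hg : g ≠ 0) : |(g ^ 2)⁻¹| * (g * p) ^ 2 * K = p ^ 2 * K := by
  rw [abs_of_pos (by positivity)]
  field_simp

/-- **TWO RADII NEVER LOSE AGAINST ONE**: for flat data the per-plaquette constants compare as
`3·(2O∕Rad)²∕(2 − 1) = 12x∕Rad² ≤ 3x∕(Rad − 1)` (`x = |β|O² ≥ 0`, `Rad > 1`) — equivalent to `(Rad − 2)² ≥ 0`; the gain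
factor is `4(Rad − 1)∕Rad² ≈ 4∕Rad = 4S∕r_Φ`. [folklore] -/
theorem twoRadii_le_oneRadius {x Rad : ℝ} (hx : 0 ≤ x) (hRad : 1 < Rad) :
    12 * x / Rad ^ 2 ≤ 3 * x / (Rad - 1) := by
  have hR : 0 < Rad := by linarith
  have hR1 : 0 < Rad - 1 := by linarith
  rw [div_le_div_iff₀ (by positivity) hR1]
  nlinarith [sq_nonneg (Rad - 2)]

end Arithmetic

/-! ## §2 The Schwarz transfer for Banach-valued curves: inner-disc oscillation and sup -/

section Schwarz

variable {F : Type*} [NormedAddCommGroup F] [NormedSpace ℂ F]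

/-- **SCHWARZ TRANSFER.**  A curve `E : ℂ → F` complex-differentiable on `‖w‖ < Rad` with oscillation
`‖E w − E 0‖ ≤ O` there satisfies `‖E w − E 0‖ ≤ (O∕Rad)·‖w‖` on that disc (Mathlib's Schwarz lemma
`Complex.dist_le_div_mul_dist_of_mapsTo_ball` for maps into a normed space). [folklore] -/
theorem norm_sub_le_div_mul_norm {E : ℂ → F} {Rad O : ℝ} (hEd : DifferentiableOn ℂ E (ball 0 Rad))
    (hO : ∀ w ∈ ball (0 : ℂ) Rad, ‖E w - E 0‖ ≤ O) :
    ∀ w ∈ ball (0 : ℂ) Rad, ‖E w - E 0‖ ≤ O / Rad * ‖w‖ := by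
  intro w hw
  have hmaps : MapsTo E (ball (0 : ℂ) Rad) (closedBall (E 0) O) := fun z hz =>
    mem_closedBall.2 (by rw [dist_eq_norm]; exact hO z hz)
  have h := Complex.dist_le_div_mul_dist_of_mapsTo_ball hEd hmaps hw
  rwa [dist_eq_norm, dist_zero_right] at h

/-- **INNER-DISC OSCILLATION**: on `‖w‖ < R₁` with `R₁ ≤ Rad`, `‖E w − E 0‖ ≤ O·R₁∕Rad`. [folklore] -/
theorem inner_osc_le {E : ℂ → F} {Rad R₁ O : ℝ} (hEd : DifferentiableOn ℂ E (ball 0 Rad))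
    (hO : ∀ w ∈ ball (0 : ℂ) Rad, ‖E w - E 0‖ ≤ O) (hR₁ : R₁ ≤ Rad) :
    ∀ w ∈ ball (0 : ℂ) R₁, ‖E w - E 0‖ ≤ O * R₁ / Rad := by
  intro w hw
  have hwn : ‖w‖ < R₁ := mem_ball_zero_iff.1 hw
  have hR₁0 : 0 < R₁ := (norm_nonneg w).trans_lt hwn
  have hRad : 0 < Rad := hR₁0.trans_le hR₁
  have hO0 : 0 ≤ O := by simpa using hO 0 (mem_ball_self hRad)
  calc ‖E w - E 0‖ ≤ O / Rad * ‖w‖ := norm_sub_le_div_mul_norm hEd hO w (ball_subset_ball hR₁ hw)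
    _ ≤ O / Rad * R₁ := mul_le_mul_of_nonneg_left hwn.le (div_nonneg hO0 hRad.le)
    _ = O * R₁ / Rad := by ring

/-- **INNER-DISC SUP**: with `‖E 0‖ ≤ d` in addition, `‖E w‖ ≤ d + O·R₁∕Rad` on `‖w‖ < R₁`. [folklore] -/
theorem inner_sup_le {E : ℂ → F} {Rad R₁ O d : ℝ} (hEd : DifferentiableOn ℂ E (ball 0 Rad))
    (hO : ∀ w ∈ ball (0 : ℂ) Rad, ‖E w - E 0‖ ≤ O) (hR₁ : R₁ ≤ Rad) (hd : ‖E 0‖ ≤ d) :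
    ∀ w ∈ ball (0 : ℂ) R₁, ‖E w‖ ≤ d + O * R₁ / Rad := by
  intro w hw
  calc ‖E w‖ = ‖E 0 + (E w - E 0)‖ := by rw [add_sub_cancel]
    _ ≤ ‖E 0‖ + ‖E w - E 0‖ := norm_add_le _ _
    _ ≤ d + O * R₁ / Rad := add_le_add hd (inner_osc_le hEd hO hR₁ w hw)

end Schwarz

/-! ## §3 The junction at an inner radius: S72 `hE_of_wilsonSquares` fired on the inner disc -/

section Junction

open scoped Matrix.Norms.L2Operator

variable {n : Type*} [Fintype n] [DecidableEq n] [Nonempty n]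
variable {E𝔠 : Type*} [AddCommGroup E𝔠] [Module ℝ E𝔠]

/-- **END-II's WILSON `hE` AT AN INNER RADIUS.**  Data as in S72 `hE_of_wilsonSquares` but ON THE BIG DISC `‖w‖ < Rad`:
per window point `x ∈ W` and plaquette `p ∈ P x` a matrix curve `E x p`, holomorphic there, with centre size
`‖E x p 0‖ ≤ d x p` (the frozen prefactor's `‖B_p − 1‖`; `0` when flat) and oscillation `‖E x p w − E x p 0‖ ≤ O x p`,
unitary on the real segment, dictionary as in S72; an INNER radius `1 < R₁ ≤ Rad` and the budget
`Σ_p |β|·(d x p + O x p·R₁∕Rad)·(O x p·R₁∕Rad) ≤ H̄`.  CONCLUSION: END-II's binder LITERALLY,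
`𝓔(c•x) ≤ 𝓔 x + (1 − c)·(3H̄∕(R₁ − 1))` — S72 at radius `R₁` on the inner-disc data of §2. [folklore] -/
theorem hE_of_wilsonSquares_innerRadius {W : Set E𝔠} {ι : Type*} (P : E𝔠 → Finset ι)
    (E : E𝔠 → ι → ℂ → Matrix n n ℂ) {Rad R₁ β Hbar : ℝ} {d O : E𝔠 → ι → ℝ} (hR₁ : 1 < R₁) (hR₁Rad : R₁ ≤ Rad)
    (hEd : ∀ x ∈ W, ∀ p ∈ P x, DifferentiableOn ℂ (E x p) (ball 0 Rad))
    (hd : ∀ x ∈ W, ∀ p ∈ P x, ‖E x p 0‖ ≤ d x p)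
    (hO : ∀ x ∈ W, ∀ p ∈ P x, ∀ w ∈ ball (0 : ℂ) Rad, ‖E x p w - E x p 0‖ ≤ O x p)
    (hsum : ∀ x ∈ W, ∑ p ∈ P x, |β| * (d x p + O x p * R₁ / Rad) * (O x p * R₁ / Rad) ≤ Hbar)
    (hunit : ∀ x ∈ W, ∀ p ∈ P x, ∀ c : ℝ, 0 ≤ c → c ≤ 1 → (1 + E x p c) * (1 + E x p c)ᴴ = 1)
    {𝓔 : E𝔠 → ℝ}
    (hdict : ∀ x ∈ W, ∀ c : ℝ, 0 ≤ c → c ≤ 1 →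
      𝓔 (c • x) = ∑ p ∈ P x, β * (1 - (Matrix.trace (1 + E x p (c : ℂ))).re / Fintype.card n)) :
    ∀ x ∈ W, ∀ c : ℝ, 1 / 2 ≤ c → c ≤ 1 → 𝓔 (c • x) ≤ 𝓔 x + (1 - c) * (3 * Hbar / (R₁ - 1)) :=
  hE_of_wilsonSquares P E (R := R₁) (H := fun x p => d x p + O x p * R₁ / Rad) (O := fun x p => O x p * R₁ / Rad)
    hR₁ (fun x hx p hp => (hEd x hx p hp).mono (ball_subset_ball hR₁Rad))
    (fun x hx p hp => inner_sup_le (hEd x hx p hp) (hO x hx p hp) hR₁Rad (hd x hx p hp))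
    (fun x hx p hp => inner_osc_le (hEd x hx p hp) (hO x hx p hp) hR₁Rad) hsum hunit hdict

/-- **THE TWO-RADII JUNCTION (`R₁ = 2`).**  For `2 ≤ Rad` and the budget
`Σ_p |β|·(d x p + 2·O x p∕Rad)·(2·O x p∕Rad) ≤ H̄` — SECOND ORDER in `1∕Rad = S∕r_Φ` — END-II's binder reads
`𝓔(c•x) ≤ 𝓔 x + (1 − c)·(3H̄)`. [folklore] -/
theorem hE_of_wilsonSquares_schwarz {W : Set E𝔠} {ι : Type*} (P : E𝔠 → Finset ι)
    (E : E𝔠 → ι → ℂ → Matrix n n ℂ) {Rad β Hbar : ℝ} {d O : E𝔠 → ι → ℝ} (hRad : 2 ≤ Rad)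
    (hEd : ∀ x ∈ W, ∀ p ∈ P x, DifferentiableOn ℂ (E x p) (ball 0 Rad))
    (hd : ∀ x ∈ W, ∀ p ∈ P x, ‖E x p 0‖ ≤ d x p)
    (hO : ∀ x ∈ W, ∀ p ∈ P x, ∀ w ∈ ball (0 : ℂ) Rad, ‖E x p w - E x p 0‖ ≤ O x p)
    (hsum : ∀ x ∈ W, ∑ p ∈ P x, |β| * (d x p + 2 * O x p / Rad) * (2 * O x p / Rad) ≤ Hbar)
    (hunit : ∀ x ∈ W, ∀ p ∈ P x, ∀ c : ℝ, 0 ≤ c → c ≤ 1 → (1 + E x p c) * (1 + E x p c)ᴴ = 1)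
    {𝓔 : E𝔠 → ℝ}
    (hdict : ∀ x ∈ W, ∀ c : ℝ, 0 ≤ c → c ≤ 1 →
      𝓔 (c • x) = ∑ p ∈ P x, β * (1 - (Matrix.trace (1 + E x p (c : ℂ))).re / Fintype.card n)) :
    ∀ x ∈ W, ∀ c : ℝ, 1 / 2 ≤ c → c ≤ 1 → 𝓔 (c • x) ≤ 𝓔 x + (1 - c) * (3 * Hbar) := by
  have hsum' : ∀ x ∈ W, ∑ p ∈ P x, |β| * (d x p + O x p * 2 / Rad) * (O x p * 2 / Rad) ≤ Hbar := by
    intro x hx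
    have e : ∀ p, O x p * 2 / Rad = 2 * O x p / Rad := fun p => by ring
    simp_rw [e]
    exact hsum x hx
  intro x hx c hc hc1
  have h := hE_of_wilsonSquares_innerRadius P E one_lt_two hRad hEd hd hO hsum' hunit hdict x hx c hc hc1
  rwa [show (2 : ℝ) - 1 = 1 by norm_num, div_one] at h

/-- NON-VACUITY of the junction's binder shapes (trigger c3): the FLAT toy on `M_1(ℂ)` — one plaquette per window point
with the constant curve `E ≡ 0` (unitary), `d = O = H̄ = 0`, `Rad = 2`, ray profile `𝓔 ≡ 0`; every hypothesis is met
and the conclusion is `0 ≤ 0 + (1 − c)·0`. [folklore] -/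
example : ∀ x ∈ (univ : Set ℝ), ∀ c : ℝ, 1 / 2 ≤ c → c ≤ 1 →
    (fun _ : ℝ => (0 : ℝ)) (c • x) ≤ (fun _ : ℝ => (0 : ℝ)) x + (1 - c) * (3 * 0) :=
  hE_of_wilsonSquares_schwarz (n := Fin 1) (W := univ) (fun _ => ({()} : Finset Unit))
    (fun _ _ _ => (0 : Matrix (Fin 1) (Fin 1) ℂ)) (Rad := 2) (β := 1) (Hbar := 0) (d := fun _ _ => 0)
    (O := fun _ _ => 0) le_rfl (fun _ _ _ _ => differentiableOn_const _) (by simp) (by simp) (by simp)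
    (by intros; simp) (𝓔 := fun _ : ℝ => (0 : ℝ)) (by intros; simp)

/-! ## §4 The letter-curve form: S74 §3's hypotheses verbatim on the big disc, the budget second order -/

/-- **END-II's WILSON `hE` FROM PLAQUETTES GIVEN AS LETTER CURVES — TWO RADII.**  Exactly the data of S74
`hE_of_wilsonPlaquettes` on the disc `‖w‖ < Rad` (frozen unitary prefactors `Bf x p` with `‖Bf x p − 1‖ ≤ d x p`, at most
`m` letter curves per plaquette, holomorphic, vanishing at `0`, bounded by `a x p`, letter-sum bound `s₁ x p`, skew on
`[0,1]`, the dictionary), with `2 ≤ Rad` and the SECOND-ORDER budget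
`Σ_p |β|·(d x p + 2S x p∕Rad)·(2S x p∕Rad) ≤ H̄`, `S := s₁ + expTail₂(m·a)`.  CONCLUSION: END-II's binder with constant
`3H̄` (no `1∕(Rad − 1)`: it sits, squared, inside `H̄`). [folklore] -/
theorem hE_of_wilsonPlaquettes_schwarz {W : Set E𝔠} {ι : Type*} (P : E𝔠 → Finset ι)
    (Bf : E𝔠 → ι → Matrix n n ℂ) (Xs : E𝔠 → ι → List (ℂ → Matrix n n ℂ)) {Rad β Hbar : ℝ}
    {d a s₁ : E𝔠 → ι → ℝ} {m : ℕ} (hRad : 2 ≤ Rad)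
    (hBu : ∀ x ∈ W, ∀ p ∈ P x, Bf x p ∈ unitary (Matrix n n ℂ)) (hBd : ∀ x ∈ W, ∀ p ∈ P x, ‖Bf x p - 1‖ ≤ d x p)
    (hlen : ∀ x ∈ W, ∀ p ∈ P x, (Xs x p).length ≤ m)
    (hXd : ∀ x ∈ W, ∀ p ∈ P x, ∀ X ∈ Xs x p, DifferentiableOn ℂ X (ball 0 Rad))
    (hX0 : ∀ x ∈ W, ∀ p ∈ P x, ∀ X ∈ Xs x p, X 0 = 0)
    (ha0 : ∀ x ∈ W, ∀ p ∈ P x, 0 ≤ a x p)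
    (ha : ∀ x ∈ W, ∀ p ∈ P x, ∀ X ∈ Xs x p, ∀ w ∈ ball (0 : ℂ) Rad, ‖X w‖ ≤ a x p)
    (hs : ∀ x ∈ W, ∀ p ∈ P x, ∀ w ∈ ball (0 : ℂ) Rad, ‖((Xs x p).map fun X => X w).sum‖ ≤ s₁ x p)
    (hskew : ∀ x ∈ W, ∀ p ∈ P x, ∀ c : ℝ, 0 ≤ c → c ≤ 1 → ∀ X ∈ Xs x p, X c ∈ skewAdjoint (Matrix n n ℂ))
    (hsum : ∀ x ∈ W, ∑ p ∈ P x, |β| * (d x p + 2 * (s₁ x p + expTail₂ (m * a x p)) / Rad) *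
      (2 * (s₁ x p + expTail₂ (m * a x p)) / Rad) ≤ Hbar)
    {𝓔 : E𝔠 → ℝ}
    (hdict : ∀ x ∈ W, ∀ c : ℝ, 0 ≤ c → c ≤ 1 →
      𝓔 (c • x) = ∑ p ∈ P x, β * (1 - (Matrix.trace (Bf x p * (((Xs x p).map fun X => X (c : ℂ)).map
        NormedSpace.exp).prod)).re / Fintype.card n)) :
    ∀ x ∈ W, ∀ c : ℝ, 1 / 2 ≤ c → c ≤ 1 → 𝓔 (c • x) ≤ 𝓔 x + (1 - c) * (3 * Hbar) := by
  refine hE_of_wilsonSquares_schwarz P (fun x p w => Bf x p * (1 + plaquetteFn (Xs x p) w) - 1) (d := d)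
    (O := fun x p => s₁ x p + expTail₂ (m * a x p)) hRad
    (fun x hx p hp => (((differentiableOn_const _).mul ((differentiableOn_const _).add
      (differentiableOn_plaquetteFn (hXd x hx p hp)))).sub_const 1))
    (fun x hx p hp => ?_) (fun x hx p hp w hw => ?_) hsum
    (fun x hx p hp c hc0 hc1 => one_add_curve_mul_conjTranspose (hBu x hx p hp) (hskew x hx p hp c hc0 hc1)) ?_
  · -- centre: `plaquetteFn Xs 0 = 0`, so `E 0 = Bf − 1`
    have h := norm_plaquetteFn_osc_le (Xs x p) (ha0 x hx p hp) (hlen x hx p hp) (hX0 x hx p hp) (ha x hx p hp)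
      (hs x hx p hp)
    simp only [h.1, add_zero, mul_one]
    exact hBd x hx p hp
  · -- oscillation on the big disc: the prefactor drops out
    have h := norm_plaquetteFn_osc_le (Xs x p) (ha0 x hx p hp) (hlen x hx p hp) (hX0 x hx p hp) (ha x hx p hp)
      (hs x hx p hp)
    rw [(norm_curve_le (hBu x hx p hp) _ w).2]
    exact h.2.2 w hw
  · intro x hx c hc0 hc1
    rw [hdict x hx c hc0 hc1]
    refine Finset.sum_congr rfl fun p _ => ?_
    rw [add_sub_cancel, one_add_plaquetteFn]

end Junction

end Summit.QuantumFields.BalabanUV.T4Continuum.ShellMeasureWilsonSquareSchwarz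

end
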